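import Mathlib.Analysis.Convex.Deriv
import Summits.HubbardSuperconductivity.HubbardSuperconductivity.Theorems.ThermalWedgeTwSeededEnsembleEquivalenceRSourcedPressureBasics
import Summits.HubbardSuperconductivity.HubbardSuperconductivity.Theorems.ThermalWedgeTwSeededEnsembleEquivalenceBracketOfSourcedLimit

/-!
# Crux `TwSeededEnsembleEquivalenceR` (stmt-HubbardSuperconductivity-15581), line `cold-floor-collapse`
# (slug `Sketch`) — ENGINE-FACING NORMAL FORM OF THE PHYSICS STUB DIFF

Support file (`--supports stmt-HubbardSuperconductivity-15581`; sorry-free; no definition).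

The line is closed modulo its two physics stubs DIFF (`stub_sourcedColdDiff`) and UNIQ′
(`stub_sourcedColdUniq`) (`twR_of_coldDiff_coldUniq`, …ROfColdDiffUniq.lean). DIFF as registered speaks of
an abstract pointwise thermodynamic limit `q` of the sourced torus pressure at `β = e^{a/U}` and asks for
`μ`-differentiability of `q(·,h)`. A constructive (multiscale) fermionic expansion never produces such a
statement directly: what it produces is a FINITE-VOLUME bound, uniform in the side `L`, on the Duhamel
density–density response, i.e. on the second `μ`-difference of the finite-volume pressure
(bounded compressibility). This file proves, kernel-checked, that the finite-volume statement suffices: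

* `sdc_hasDerivAt_of_convexOn_of_second_difference_le` (pure real analysis): a function convex on a set `S`,
  at an interior point `x`, whose symmetric second difference satisfies
  `f(x+t) + f(x−t) − 2f(x) ≤ M t²` for `0 < t ≤ t₀`, is differentiable at `x` (its left and right derivatives,
  which exist by convexity, are squeezed together: `f'₊(x) − f'₋(x) ≤ M t → 0`).
* `sdc_stub_sourcedColdDiff_of_compressibility` — **E_DIFF ⟹ DIFF** with DIFF the registered signature of
  `stub_sourcedColdDiff` VERBATIM, where E_DIFF has the same quantifier prefix and asserts, for every
  `μ ∈ (μ₁,μ₂)` and `|h| ≤ 13g+1`, a bound `p̃_L(μ+t,h) + p̃_L(μ−t,h) − 2p̃_L(μ,h) ≤ M t²` for `0 < t ≤ t₀`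
  and all large `L` (`M, t₀` may depend on everything but `L, t`). Proof: convexity of `p̃_L(·,h)`
  (`cfb_convexOn_sourcedPressure`) passes to the pointwise limit `q(·,h)` on `[μ₁,μ₂]`
  (`bdl_convexOn_of_limit`), so does the second-difference bound, and the lemma above applies on
  `interior [μ₁,μ₂] = (μ₁,μ₂)`.

So the physics input DIFF of crux R may be filed / attacked in the finite-volume form E_DIFF (uniformly-in-`L`
bounded compressibility of the `d`-wave-sourced weakly repulsive Hubbard torus at `β = e^{a/U}`), which is the
form a Benfatto–Giuliani–Mastropietro-class expansion "one `μ`-derivative deep" delivers. [folklore composition]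
-/

set_option linter.dupNamespace false

namespace Summit.HubbardSuperconductivity.HubbardSuperconductivity.Theorems

open Matrix Set Filter Topology Literature.MathematicalPhysics.QuantumLattice
open Summit.HubbardSuperconductivity.HubbardSuperconductivity.Theorems.TwSeededEnsembleEquivalence.ThermalDuality
open Summit.HubbardSuperconductivity.HubbardSuperconductivity.Theorems.TwSeededEnsembleEquivalenceR.ColdFloorLine
open scoped ComplexOrder

noncomputable section

/-! ### Pure real analysis: convexity + `O(t²)` symmetric second difference ⇒ differentiability -/

/-- **A convex function with an `O(t²)` symmetric second difference at an interior point is differentiable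
there.** If `f` is convex on `S`, `x ∈ interior S`, and `f(x+t) + f(x−t) − 2 f(x) ≤ M t²` for `0 < t ≤ t₀`
(`t₀ > 0`), then `f` has derivative `f'₊(x)` (its right derivative) at `x`: by convexity the one-sided
derivatives exist with `f'₋(x) ≤ f'₊(x)`, and `f'₊(x) ≤ (f(x+t) − f(x))/t`, `(f(x) − f(x−t))/t ≤ f'₋(x)` give
`f'₊(x) − f'₋(x) ≤ M t` for all small `t > 0`. [folklore: Rockafellar, Convex Analysis, Thm 25.1-class] -/
theorem sdc_hasDerivAt_of_convexOn_of_second_difference_le {S : Set ℝ} {f : ℝ → ℝ} {x M t₀ : ℝ}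
    (hfc : ConvexOn ℝ S f) (hxs : x ∈ interior S) (ht₀ : 0 < t₀)
    (h2 : ∀ t : ℝ, 0 < t → t ≤ t₀ → f (x + t) + f (x - t) - 2 * f x ≤ M * t ^ 2) :
    HasDerivAt f (derivWithin f (Ioi x) x) x := by
  have hx' := hxs
  rw [mem_interior_iff_mem_nhds, mem_nhds_iff_exists_Ioo_subset] at hx'
  obtain ⟨a, b, hxab, habs⟩ := hx'
  set r := derivWithin f (Ioi x) x with hr_def
  set l := derivWithin f (Iio x) x with hl_def
  have hr : HasDerivWithinAt f r (Ioi x) x := hfc.hasDerivWithinAt_rightDeriv_of_mem_interior hxs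
  have hl : HasDerivWithinAt f l (Iio x) x := hfc.hasDerivWithinAt_leftDeriv_of_mem_interior hxs
  have hlr : l ≤ r := hfc.leftDeriv_le_rightDeriv_of_mem_interior hxs
  -- the squeeze `r - l ≤ M t` for every admissible `t`
  have hsq : ∀ t : ℝ, 0 < t → t ≤ t₀ → x + t < b → a < x - t → r - l ≤ M * t := by
    intro t ht htt htb hta
    have hyS : x + t ∈ S := habs ⟨by linarith [hxab.1], htb⟩
    have hzS : x - t ∈ S := habs ⟨hta, by linarith [hxab.2]⟩
    have h1 : r ≤ slope f x (x + t) :=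
      hfc.rightDeriv_le_slope_of_mem_interior hxs hyS (by linarith)
    have h3 : slope f (x - t) x ≤ l :=
      hfc.slope_le_leftDeriv_of_mem_interior hzS hxs (by linarith)
    rw [slope_def_field] at h1 h3
    have e1 : x + t - x = t := by ring
    have e2 : x - (x - t) = t := by ring
    rw [e1, le_div_iff₀ ht] at h1
    rw [e2, div_le_iff₀ ht] at h3
    have h4 := h2 t ht htt
    nlinarith
  have hrl : r ≤ l := by
    by_contra hcon
    push Not at hcon
    have hd : 0 < r - l := by linarith
    -- an admissible `t` with `M t < r - l`
    set t : ℝ := min t₀ (min ((b - x) / 2) (min ((x - a) / 2) ((r - l) / (2 * (|M| + 1))))) with ht_def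
    have hM1 : 0 < |M| + 1 := by positivity
    have ht0 : 0 < t := by
      simp only [ht_def, lt_min_iff]
      refine ⟨ht₀, by linarith [hxab.2], by linarith [hxab.1], by positivity⟩
    have htt₀ : t ≤ t₀ := min_le_left _ _
    have htb : x + t < b := by
      have : t ≤ (b - x) / 2 := (min_le_right _ _).trans (min_le_left _ _)
      linarith [hxab.2]
    have hta : a < x - t := by
      have : t ≤ (x - a) / 2 := ((min_le_right _ _).trans (min_le_right _ _)).trans (min_le_left _ _)
      linarith [hxab.1]
    have htq : t ≤ (r - l) / (2 * (|M| + 1)) :=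
      ((min_le_right _ _).trans (min_le_right _ _)).trans (min_le_right _ _)
    have key := hsq t ht0 htt₀ htb hta
    -- `M t ≤ |M| t ≤ |M| (r - l)/(2(|M|+1)) < r - l`
    have hMt : M * t ≤ |M| * t := mul_le_mul_of_nonneg_right (le_abs_self M) ht0.le
    have hMt' : |M| * t ≤ |M| * ((r - l) / (2 * (|M| + 1))) :=
      mul_le_mul_of_nonneg_left htq (abs_nonneg M)
    have hlt : |M| * ((r - l) / (2 * (|M| + 1))) < r - l := by
      rw [← mul_div_assoc, div_lt_iff₀ (by positivity)]
      nlinarith [abs_nonneg M]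
    linarith
  have hrl' : l = r := le_antisymm hlr hrl
  rw [hrl'] at hl
  have hu : HasDerivWithinAt f r (Iio x ∪ Ioi x) x := hl.union hr
  rw [Iio_union_Ioi, compl_eq_univ_sdiff, hasDerivWithinAt_sdiff_singleton, hasDerivWithinAt_univ] at hu
  exact hu

/-- Corollary: differentiability. [folklore] -/
theorem sdc_differentiableAt_of_convexOn_of_second_difference_le {S : Set ℝ} {f : ℝ → ℝ}
    {x M t₀ : ℝ} (hfc : ConvexOn ℝ S f) (hxs : x ∈ interior S) (ht₀ : 0 < t₀)
    (h2 : ∀ t : ℝ, 0 < t → t ≤ t₀ → f (x + t) + f (x - t) - 2 * f x ≤ M * t ^ 2) :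
    DifferentiableAt ℝ f x :=
  (sdc_hasDerivAt_of_convexOn_of_second_difference_le hfc hxs ht₀ h2).differentiableAt

/-- Three-term linear combinations of limits inherit eventual upper bounds: if `uₙ → A`, `vₙ → B`,
`wₙ → C` (`ε`–`N` form) and `uₙ + vₙ − 2wₙ ≤ D` eventually, then `A + B − 2C ≤ D`. [folklore] -/
theorem sdc_add_sub_two_mul_le_of_limits {u v w : ℕ → ℝ} {A B C D : ℝ}
    (hu : ∀ κ : ℝ, 0 < κ → ∃ N : ℕ, ∀ n, N ≤ n → |u n - A| ≤ κ)
    (hv : ∀ κ : ℝ, 0 < κ → ∃ N : ℕ, ∀ n, N ≤ n → |v n - B| ≤ κ)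
    (hw : ∀ κ : ℝ, 0 < κ → ∃ N : ℕ, ∀ n, N ≤ n → |w n - C| ≤ κ)
    (huvw : ∃ N₀ : ℕ, ∀ n, N₀ ≤ n → u n + v n - 2 * w n ≤ D) : A + B - 2 * C ≤ D := by
  apply le_of_forall_pos_lt_add
  intro ε hε
  obtain ⟨N₁, hN₁⟩ := hu (ε / 8) (by positivity)
  obtain ⟨N₂, hN₂⟩ := hv (ε / 8) (by positivity)
  obtain ⟨N₃, hN₃⟩ := hw (ε / 8) (by positivity)
  obtain ⟨N₀, hN₀⟩ := huvw
  set n := max N₀ (max N₁ (max N₂ N₃)) with hn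
  have h0 := hN₀ n (le_max_left _ _)
  have h1 := hN₁ n ((le_max_left _ _).trans (le_max_right _ _))
  have h2 := hN₂ n (((le_max_left _ _).trans (le_max_right _ _)).trans (le_max_right _ _))
  have h3 := hN₃ n (((le_max_right _ _).trans (le_max_right _ _)).trans (le_max_right _ _))
  rw [abs_le] at h1 h2 h3
  linarith [h1.1, h1.2, h2.1, h2.2, h3.1, h3.2]

/-! ### E_DIFF ⟹ DIFF for the sourced torus pressure at the cold slice -/

/-- **Engine-facing normal form of DIFF (`stub_sourcedColdDiff` of line `Sketch`, crux
stmt-HubbardSuperconductivity-15581).** If, on every compact window `[μ₁,μ₂] ⊂ (−4,0)`, for all small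
exponents `a ≤ a₀` (seed floor `K′`, `U ≤ U₀`), every `μ ∈ (μ₁,μ₂)` and every source `|h| ≤ 13g+1`, the
finite-volume sourced torus pressure `p̃_L(·,h)` at `β = e^{a/U}` has symmetric second `μ`-differences
`p̃_L(μ+t,h) + p̃_L(μ−t,h) − 2p̃_L(μ,h) ≤ M t²` for `0 < t ≤ t₀` uniformly in large `L` (bounded
compressibility — what a convergent expansion one `μ`-derivative deep proves), then every pointwise
thermodynamic limit `q(·,h)` of `p̃_L(·,h)` on the window is differentiable on `(μ₁,μ₂)` — the registered
signature of `stub_sourcedColdDiff`, verbatim. [folklore composition] -/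
theorem sdc_stub_sourcedColdDiff_of_compressibility :
    (∀ (μ₁ μ₂ : ℝ), -4 < μ₁ → μ₁ < μ₂ → μ₂ < 0 → ∃ a₀ : ℝ, 0 < a₀ ∧ ∀ a ∈ Set.Ioc (0 : ℝ) a₀,
      ∃ K' U₀ : ℝ, 0 < K' ∧ 0 < U₀ ∧ ∀ U ∈ Set.Ioc (0 : ℝ) U₀, ∀ g ∈ Set.Icc (K' * U) (1 / 10),
        ∀ μ ∈ Set.Ioo μ₁ μ₂, ∀ h ∈ Set.Icc (-(13 * g + 1)) (13 * g + 1),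
          ∃ M t₀ : ℝ, 0 < t₀ ∧ ∃ L₀ : ℕ, ∀ (L : ℕ) [NeZero L], L₀ ≤ L → ∀ t : ℝ, 0 < t → t ≤ t₀ →
            Real.log (Matrix.partitionFn (Real.exp (a / U)) (dWaveSourceTorus L U (μ + t) h)).re /
                  (Real.exp (a / U) * (L : ℝ) ^ 2) +
                Real.log (Matrix.partitionFn (Real.exp (a / U)) (dWaveSourceTorus L U (μ - t) h)).re /
                  (Real.exp (a / U) * (L : ℝ) ^ 2) -
              2 * (Real.log (Matrix.partitionFn (Real.exp (a / U)) (dWaveSourceTorus L U μ h)).re /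
                  (Real.exp (a / U) * (L : ℝ) ^ 2)) ≤ M * t ^ 2) →
    ∀ (μ₁ μ₂ : ℝ), -4 < μ₁ → μ₁ < μ₂ → μ₂ < 0 → ∃ a₀ : ℝ, 0 < a₀ ∧ ∀ a ∈ Set.Ioc (0 : ℝ) a₀,
      ∃ K' U₀ : ℝ, 0 < K' ∧ 0 < U₀ ∧ ∀ U ∈ Set.Ioc (0 : ℝ) U₀, ∀ g ∈ Set.Icc (K' * U) (1 / 10),
        ∀ q : ℝ → ℝ → ℝ,
          (∀ μ ∈ Set.Icc μ₁ μ₂, ∀ h ∈ Set.Icc (-(13 * g + 1)) (13 * g + 1), ∀ κ : ℝ, 0 < κ →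
            ∃ L₀ : ℕ, ∀ (L : ℕ) [NeZero L], L₀ ≤ L →
              |Real.log (Matrix.partitionFn (Real.exp (a / U)) (dWaveSourceTorus L U μ h)).re /
                  (Real.exp (a / U) * (L : ℝ) ^ 2) - q μ h| ≤ κ) →
          ∀ μ ∈ Set.Ioo μ₁ μ₂, ∀ h ∈ Set.Icc (-(13 * g + 1)) (13 * g + 1),
            DifferentiableAt ℝ (fun μ' => q μ' h) μ := by
  intro hE μ₁ μ₂ h4 h12 h0
  obtain ⟨a₀, ha₀, hA⟩ := hE μ₁ μ₂ h4 h12 h0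
  refine ⟨a₀, ha₀, fun a ha => ?_⟩
  obtain ⟨K', U₀, hK', hU₀, hB⟩ := hA a ha
  refine ⟨K', U₀, hK', hU₀, fun U hU g hg q hq μ hμ h hh => ?_⟩
  obtain ⟨M, t₀, ht₀, L₀, hL₀⟩ := hB U hU g hg μ hμ h hh
  set β : ℝ := Real.exp (a / U) with hβ_def
  have hβ : 0 < β := Real.exp_pos _
  -- sequence form (side `n + 1`) of the finite-volume pressures at the fixed source `h`
  set P : ℕ → ℝ → ℝ := fun n μ' =>
    Real.log (partitionFn β (dWaveSourceTorus (n + 1) U μ' h)).re / (β * ((n + 1 : ℕ) : ℝ) ^ 2)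
    with hP_def
  have hseq : ∀ μ' ∈ Set.Icc μ₁ μ₂, ∀ κ : ℝ, 0 < κ → ∃ N : ℕ, ∀ n, N ≤ n → |P n μ' - q μ' h| ≤ κ := by
    intro μ' hμ' κ hκ
    obtain ⟨L₁, hL₁⟩ := hq μ' hμ' h hh κ hκ
    exact ⟨L₁, fun n hn => hL₁ (n + 1) (by omega)⟩
  -- convexity of the limit on the window
  have hconv : ConvexOn ℝ (Set.Icc μ₁ μ₂) (fun μ' => q μ' h) := by
    refine bdl_convexOn_of_limit (convex_Icc μ₁ μ₂) P (fun μ' => q μ' h) (fun n => ?_) hseq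
    exact (cfb_convexOn_sourcedPressure (n + 1) U h hβ).subset (Set.subset_univ _) (convex_Icc μ₁ μ₂)
  -- second-difference bound for the limit at `μ`, for `0 < t ≤ t₁`
  set t₁ : ℝ := min t₀ (min (μ₂ - μ) (μ - μ₁)) with ht₁_def
  have ht₁ : 0 < t₁ := by
    simp only [ht₁_def, lt_min_iff]
    exact ⟨ht₀, by linarith [hμ.2], by linarith [hμ.1]⟩
  have h2 : ∀ t : ℝ, 0 < t → t ≤ t₁ →
      q (μ + t) h + q (μ - t) h - 2 * q μ h ≤ M * t ^ 2 := by
    intro t ht htt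
    have htt₀ : t ≤ t₀ := htt.trans (min_le_left _ _)
    have ht2 : t ≤ μ₂ - μ := htt.trans ((min_le_right _ _).trans (min_le_left _ _))
    have ht1 : t ≤ μ - μ₁ := htt.trans ((min_le_right _ _).trans (min_le_right _ _))
    have hp : μ + t ∈ Set.Icc μ₁ μ₂ := ⟨by linarith [hμ.1], by linarith⟩
    have hm : μ - t ∈ Set.Icc μ₁ μ₂ := ⟨by linarith, by linarith [hμ.2]⟩
    have h0' : μ ∈ Set.Icc μ₁ μ₂ := ⟨hμ.1.le, hμ.2.le⟩
    refine sdc_add_sub_two_mul_le_of_limits (hseq _ hp) (hseq _ hm) (hseq _ h0') ⟨L₀, fun n hn => ?_⟩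
    exact hL₀ (n + 1) (by omega) t ht htt₀
  have hint : μ ∈ interior (Set.Icc μ₁ μ₂) := by
    rw [interior_Icc]; exact hμ
  exact sdc_differentiableAt_of_convexOn_of_second_difference_le hconv hint ht₁ h2

end

end Summit.HubbardSuperconductivity.HubbardSuperconductivity.Theorems
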